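import Summits.ResolutionOfSingularities.ResolutionOfSingularities.Theorems.FrobeniusLadderFInjectiveMacaulayficationX2Cubic4Specimen
import HarnessLib

/-!
# THE (C31) BED `x² + y³ + u³ + t³ + s³ + y²u` — the first NON-DIAGONAL member of the T-side class row: prime, and regular off the vertex (`p ∉ {2, 3, 31}`)
# (crux `FInjectiveMacaulayfication` stmt-ResolutionOfSingularities-15315, chain w45a; res-L1-w45a-plan-1 ANSWER 00:15Z (C′) «a NON-diagonal application … where pointwise derivations are
# genuinely needed»; input side for ✓p682339 `X2CubicFormTStepRow.tStep_row_of_doublePoint_cubicForm`; seat res-L1-w45a-lead-1 g11)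

[OURS · L1 W4.5a] Support file (`--supports stmt-ResolutionOfSingularities-15315 --as helper`); def-free; UNCONDITIONAL; no named fact; NOT a statement of any manuscript. AI-written
(AI review is weaker than expert review).

`f = X₄² + X₀³ + X₁³ + X₂³ + X₃³ + X₀²X₁` (`X 0..3 = y,u,t,s`, `X 4 = x`). The cubic surface `{y³+u³+t³+s³+y²u = 0} ⊂ ℙ³` is SMOOTH exactly when `char k ∉ {2?, 3, 31}` — the prime
`31` is the resultant constant of `(u³ + u + 1, 3u² + 1)` and of `(y³ + y² + 1, 3y² + 2y)`; it enters the isolatedness proof below through the identity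
`31·y² = 4·(3u² + y²) − 3·(2u − 3y)(2u + 3y)`.
* §1 `pderiv_*_f`, `constantCoeff_f`, ★ `prime_f` (`3 ≠ 0`: `T² + C(c)` Eisenstein-type at the rational point `(−1, 0, 1, 0)` of `c`, `∂_t c = 3`), `f_not_mem_span_X`;
* §2 ★ `regular_off_vertex` (`2, 3, 31 ≠ 0`; Jacobian, with the `31y²` identity in the `y,u`-direction), `regular_of_ne_vertex`.
[cite: Hartshorne1977, I Thm. 5.1] [folklore]
-/

-- single-problem summit: the doubled namespace component is forced
set_option linter.dupNamespace false

noncomputable section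

open AlgebraicGeometry CategoryTheory Literature.AlgebraicGeometry.Resolution TopologicalSpace IsLocalRing MvPolynomial

namespace Summit.ResolutionOfSingularities.ResolutionOfSingularities.Theorems.FInjectiveMacaulayfication.X2C31Specimen

open Summit.ResolutionOfSingularities.ResolutionOfSingularities.Theorems.FInjectiveMacaulayfication

/-! ## §1 The polynomial -/

/-- `∂f/∂x = 2x`. [elementary] -/
theorem pderiv_four_f (k : Type) [Field k] (f : MvPolynomial (Fin 5) k) (hf : f = X 4 ^ 2 + X 0 ^ 3 + X 1 ^ 3 + X 2 ^ 3 + X 3 ^ 3 + X 0 ^ 2 * X 1) :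
    pderiv 4 f = 2 * X 4 := by
  rw [hf]
  simp only [map_add, Derivation.leibniz, Derivation.leibniz_pow, pderiv_X_self, pderiv_X_of_ne (show (0 : Fin 5) ≠ 4 by decide),
    pderiv_X_of_ne (show (1 : Fin 5) ≠ 4 by decide), pderiv_X_of_ne (show (2 : Fin 5) ≠ 4 by decide), pderiv_X_of_ne (show (3 : Fin 5) ≠ 4 by decide),
    smul_eq_mul, mul_one, nsmul_eq_mul]
  push_cast; ring

/-- `∂f/∂y = 3y² + 2yu`. [elementary] -/
theorem pderiv_zero_f (k : Type) [Field k] (f : MvPolynomial (Fin 5) k) (hf : f = X 4 ^ 2 + X 0 ^ 3 + X 1 ^ 3 + X 2 ^ 3 + X 3 ^ 3 + X 0 ^ 2 * X 1) :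
    pderiv 0 f = 3 * X 0 ^ 2 + 2 * X 0 * X 1 := by
  rw [hf]
  simp only [map_add, Derivation.leibniz, Derivation.leibniz_pow, pderiv_X_self, pderiv_X_of_ne (show (4 : Fin 5) ≠ 0 by decide),
    pderiv_X_of_ne (show (1 : Fin 5) ≠ 0 by decide), pderiv_X_of_ne (show (2 : Fin 5) ≠ 0 by decide), pderiv_X_of_ne (show (3 : Fin 5) ≠ 0 by decide),
    smul_eq_mul, mul_one, nsmul_eq_mul]
  push_cast; ring

/-- `∂f/∂u = 3u² + y²`. [elementary] -/
theorem pderiv_one_f (k : Type) [Field k] (f : MvPolynomial (Fin 5) k) (hf : f = X 4 ^ 2 + X 0 ^ 3 + X 1 ^ 3 + X 2 ^ 3 + X 3 ^ 3 + X 0 ^ 2 * X 1) :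
    pderiv 1 f = 3 * X 1 ^ 2 + X 0 ^ 2 := by
  rw [hf]
  simp only [map_add, Derivation.leibniz, Derivation.leibniz_pow, pderiv_X_self, pderiv_X_of_ne (show (4 : Fin 5) ≠ 1 by decide),
    pderiv_X_of_ne (show (0 : Fin 5) ≠ 1 by decide), pderiv_X_of_ne (show (2 : Fin 5) ≠ 1 by decide), pderiv_X_of_ne (show (3 : Fin 5) ≠ 1 by decide),
    smul_eq_mul, mul_one, nsmul_eq_mul]
  push_cast; ring

/-- `∂f/∂t = 3t²`, `∂f/∂s = 3s²`. [elementary] -/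
theorem pderiv_cube_f (k : Type) [Field k] (f : MvPolynomial (Fin 5) k) (hf : f = X 4 ^ 2 + X 0 ^ 3 + X 1 ^ 3 + X 2 ^ 3 + X 3 ^ 3 + X 0 ^ 2 * X 1)
    (j : Fin 5) (hj : j = 2 ∨ j = 3) : pderiv j f = 3 * X j ^ 2 := by
  rw [hf]
  rcases hj with rfl | rfl
  · simp only [map_add, Derivation.leibniz, Derivation.leibniz_pow, pderiv_X_self, pderiv_X_of_ne (show (4 : Fin 5) ≠ 2 by decide),
      pderiv_X_of_ne (show (0 : Fin 5) ≠ 2 by decide), pderiv_X_of_ne (show (1 : Fin 5) ≠ 2 by decide), pderiv_X_of_ne (show (3 : Fin 5) ≠ 2 by decide),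
      smul_eq_mul, mul_one, nsmul_eq_mul]
    push_cast; ring
  · simp only [map_add, Derivation.leibniz, Derivation.leibniz_pow, pderiv_X_self, pderiv_X_of_ne (show (4 : Fin 5) ≠ 3 by decide),
      pderiv_X_of_ne (show (0 : Fin 5) ≠ 3 by decide), pderiv_X_of_ne (show (1 : Fin 5) ≠ 3 by decide), pderiv_X_of_ne (show (2 : Fin 5) ≠ 3 by decide),
      smul_eq_mul, mul_one, nsmul_eq_mul]
    push_cast; ring

/-- `f` has no constant term. [elementary] -/
theorem constantCoeff_f (k : Type) [Field k] (f : MvPolynomial (Fin 5) k) (hf : f = X 4 ^ 2 + X 0 ^ 3 + X 1 ^ 3 + X 2 ^ 3 + X 3 ^ 3 + X 0 ^ 2 * X 1) :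
    constantCoeff f = 0 := by
  rw [hf]
  simp [constantCoeff_X]

/-- ★ **`f` is PRIME whenever `3 ≠ 0` in `k`**: as `T² + C(0)·T + C(c)` over `k[y,u,t,s]`, `c = y³ + u³ + t³ + s³ + y²u`, Eisenstein-type at the point `(−1, 0, 1, 0)` where `c = 0` and
`∂c/∂t = 3 ≠ 0`. [folklore] -/
theorem prime_f (k : Type) [Field k] (h3 : (3 : k) ≠ 0) (f : MvPolynomial (Fin 5) k)
    (hf : f = X 4 ^ 2 + X 0 ^ 3 + X 1 ^ 3 + X 2 ^ 3 + X 3 ^ 3 + X 0 ^ 2 * X 1) : Prime f := by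
  set e : MvPolynomial (Fin 5) k ≃+* Polynomial (MvPolynomial (Fin 4) k) :=
    ((renameEquiv k (_root_.finRotate 5)).trans (finSuccEquiv k 4)).toRingEquiv with he_def
  have hrot4 : (_root_.finRotate 5) (4 : Fin 5) = 0 := by decide
  have hrot : ∀ j : Fin 4, (_root_.finRotate 5) (Fin.castSucc j) = j.succ := by decide
  have he4 : e (X 4) = Polynomial.X := by
    show finSuccEquiv k 4 (rename _ (X 4)) = _
    rw [rename_X, hrot4]; exact finSuccEquiv_X_zero
  have hej : ∀ j : Fin 4, e (X (Fin.castSucc j)) = Polynomial.C (X j) := fun j => by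
    show finSuccEquiv k 4 (rename _ (X (Fin.castSucc j))) = _
    rw [rename_X, hrot j]; exact finSuccEquiv_X_succ (j := j)
  set c : MvPolynomial (Fin 4) k := X 0 ^ 3 + X 1 ^ 3 + X 2 ^ 3 + X 3 ^ 3 + X 0 ^ 2 * X 1 with hc
  have hef : e f = Polynomial.X ^ 2 + Polynomial.C (0 : MvPolynomial (Fin 4) k) * Polynomial.X + Polynomial.C c := by
    rw [hf, map_add, map_add, map_add, map_add, map_add, map_pow, he4, map_pow, map_pow, map_pow, map_pow, map_mul, map_pow,
      show (0 : Fin 5) = Fin.castSucc (0 : Fin 4) from rfl, show (1 : Fin 5) = Fin.castSucc (1 : Fin 4) from rfl,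
      show (2 : Fin 5) = Fin.castSucc (2 : Fin 4) from rfl, show (3 : Fin 5) = Fin.castSucc (3 : Fin 4) from rfl, hej, hej, hej, hej, hc]
    simp only [map_add, map_pow, map_mul, map_zero, zero_mul, add_zero]
    ring
  set a : Fin 4 → k := ![-1, 0, 1, 0] with ha
  have hba : MvPolynomial.eval a (0 : MvPolynomial (Fin 4) k) = 0 := map_zero _
  have hca : MvPolynomial.eval a c = 0 := by
    rw [hc]
    simp only [map_add, map_mul, map_pow, eval_X, ha, Matrix.cons_val_zero, Matrix.cons_val_one]
    simp only [Matrix.cons_val]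
    ring
  have hder : MvPolynomial.eval a (pderiv 2 c) ≠ 0 := by
    have e1 : pderiv 2 c = 3 * X 2 ^ 2 := by
      rw [hc]
      simp only [map_add, Derivation.leibniz, Derivation.leibniz_pow, pderiv_X_self, pderiv_X_of_ne (show (0 : Fin 4) ≠ 2 by decide),
        pderiv_X_of_ne (show (1 : Fin 4) ≠ 2 by decide), pderiv_X_of_ne (show (3 : Fin 4) ≠ 2 by decide), smul_eq_mul, mul_one,
        nsmul_eq_mul]
      push_cast; ring
    rw [e1, map_mul, map_pow, eval_X, ha]
    simp only [Matrix.cons_val]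
    rw [map_ofNat]
    simpa using h3
  have hirr : Irreducible (e f) := by
    rw [hef]
    exact Literature.AlgebraicGeometry.Motives.SmoothHypersurface.irreducible_X_pow_add_C_mul_X_add_C (d := 2) le_rfl 0 c a hba hca 2 hder
  exact (MulEquiv.prime_iff e).mp hirr.prime

/-- `f ∉ (Xᵢ)`: evaluate at `e₄` (`f = 1`, `i ≤ 3`) resp. at `e₂` (`f = 1`, `i = 4`). [elementary] -/
theorem f_not_mem_span_X (k : Type) [Field k] (f : MvPolynomial (Fin 5) k) (hf : f = X 4 ^ 2 + X 0 ^ 3 + X 1 ^ 3 + X 2 ^ 3 + X 3 ^ 3 + X 0 ^ 2 * X 1) (i : Fin 5) :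
    f ∉ Ideal.span {(X i : MvPolynomial (Fin 5) k)} := by
  intro h
  obtain ⟨c, hc⟩ := Ideal.mem_span_singleton.mp h
  by_cases hi : i = 4
  · subst hi
    have := congrArg (MvPolynomial.eval (Pi.single 2 1 : Fin 5 → k)) hc
    rw [hf] at this
    simp at this
  · have := congrArg (MvPolynomial.eval (Pi.single 4 1 : Fin 5 → k)) hc
    rw [hf] at this
    simp [hi] at this

/-! ## §2 Regular off the vertex -/

/-- A unit constant never lies in a prime. [plumbing] -/
theorem C_not_mem (k : Type) [Field k] {c : k} (hc : c ≠ 0) (P : Ideal (MvPolynomial (Fin 5) k)) [P.IsPrime] : (C c : MvPolynomial (Fin 5) k) ∉ P := fun h =>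
  (inferInstance : P.IsPrime).ne_top ((Ideal.eq_top_iff_one _).mpr (by
    have hu : IsUnit (C c : MvPolynomial (Fin 5) k) := (isUnit_iff_ne_zero.mpr hc).map C
    exact (Ideal.unit_mul_mem_iff_mem _ hu).mp (by simpa using h)))

/-- ★ **`(k[X]/(f))_P` is regular at every prime `P ⊉ 𝔪`** when `2, 3, 31 ≠ 0` in `k`: some `X_j ∉ P′`; for `j ∈ {2,3,4}` the partial `3X_j²` resp. `2x` misses `P′`; for `j ∈ {0,1}` one
of `∂_y f = y(3y + 2u)`, `∂_u f = 3u² + y²` misses `P′` — otherwise `31·y² = 4·∂_u f − 3·(2u − 3y)(2u + 3y) ∈ P′` forces `y ∈ P′` and then `u ∈ P′`. (Jacobian criterion,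
`HypersurfaceRegular.stub_hypersurfaceRegularOfPderiv`.) [cite: Hartshorne1977, I Thm. 5.1] -/
theorem regular_off_vertex (k : Type) [Field k] (h2 : (2 : k) ≠ 0) (h3 : (3 : k) ≠ 0) (h31 : (31 : k) ≠ 0) (f : MvPolynomial (Fin 5) k)
    (hf : f = X 4 ^ 2 + X 0 ^ 3 + X 1 ^ 3 + X 2 ^ 3 + X 3 ^ 3 + X 0 ^ 2 * X 1)
    (P : Ideal (MvPolynomial (Fin 5) k ⧸ Ideal.span {f})) [P.IsPrime]
    (hP : ¬ Ideal.span (Set.range fun j : Fin 5 => Ideal.Quotient.mk (Ideal.span {f}) (X j)) ≤ P) :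
    IsRegularLocalRing (Localization.AtPrime P) := by
  haveI hP' : (P.comap (Ideal.Quotient.mk (Ideal.span {f}))).IsPrime := Ideal.comap_isPrime _ _
  set P' := P.comap (Ideal.Quotient.mk (Ideal.span {f})) with hP'def
  have hex : ∃ j : Fin 5, (X j : MvPolynomial (Fin 5) k) ∉ P' := by
    by_contra hall
    push Not at hall
    apply hP
    rw [Ideal.span_le]
    rintro _ ⟨j, rfl⟩
    exact hall j
  have hC2 := C_not_mem k h2 P'
  have hC3 := C_not_mem k h3 P'
  have hC31 := C_not_mem k h31 P'
  -- the `y,u`-direction: one of `∂_y f`, `∂_u f` misses `P′` unless `y, u ∈ P′`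
  have hyu : (X 0 : MvPolynomial (Fin 5) k) ∉ P' ∨ (X 1 : MvPolynomial (Fin 5) k) ∉ P' → pderiv 0 f ∉ P' ∨ pderiv 1 f ∉ P' := by
    intro hor
    by_contra hboth
    push Not at hboth
    obtain ⟨hA, hB⟩ := hboth
    rw [pderiv_zero_f k f hf] at hA
    rw [pderiv_one_f k f hf] at hB
    -- `y(3y+2u) ∈ P′`
    have hA' : (X 0 : MvPolynomial (Fin 5) k) * (3 * X 0 + 2 * X 1) ∈ P' := by
      have e : (X 0 : MvPolynomial (Fin 5) k) * (3 * X 0 + 2 * X 1) = 3 * X 0 ^ 2 + 2 * X 0 * X 1 := by ring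
      rw [e]; exact hA
    have hy : (X 0 : MvPolynomial (Fin 5) k) ∈ P' := by
      rcases hP'.mem_or_mem hA' with hy | hlin
      · exact hy
      · -- `31 y² = 4(3u²+y²) − 3(2u−3y)(2u+3y)`
        have h31y : (C (31 : k) : MvPolynomial (Fin 5) k) * X 0 ^ 2 ∈ P' := by
          have e : (C (31 : k) : MvPolynomial (Fin 5) k) * X 0 ^ 2 = 4 * (3 * X 1 ^ 2 + X 0 ^ 2) - 3 * (2 * X 1 - 3 * X 0) * (3 * X 0 + 2 * X 1) := by
            rw [map_ofNat]; ring
          rw [e]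
          exact P'.sub_mem (P'.mul_mem_left _ hB) (P'.mul_mem_left _ hlin)
        rcases hP'.mem_or_mem h31y with h31' | hy2
        · exact absurd h31' hC31
        · exact hP'.mem_of_pow_mem 2 hy2
    have hu : (X 1 : MvPolynomial (Fin 5) k) ∈ P' := by
      have h3u : (C (3 : k) : MvPolynomial (Fin 5) k) * X 1 ^ 2 ∈ P' := by
        have e : (C (3 : k) : MvPolynomial (Fin 5) k) * X 1 ^ 2 = (3 * X 1 ^ 2 + X 0 ^ 2) - X 0 * X 0 := by rw [map_ofNat]; ring
        rw [e]
        exact P'.sub_mem hB (P'.mul_mem_left _ hy)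
      rcases hP'.mem_or_mem h3u with h3' | hu2
      · exact absurd h3' hC3
      · exact hP'.mem_of_pow_mem 2 hu2
    rcases hor with h0 | h1
    · exact h0 hy
    · exact h1 hu
  obtain ⟨j, hj⟩ := hex
  by_cases hj4 : j = 4
  · subst hj4
    refine HypersurfaceRegular.stub_hypersurfaceRegularOfPderiv k 5 f 4 P ?_
    rw [pderiv_four_f k f hf, show (2 : MvPolynomial (Fin 5) k) = C (2 : k) from (map_ofNat C 2).symm]
    exact fun h => (hP'.mem_or_mem h).elim hC2 hj
  by_cases hj23 : j = 2 ∨ j = 3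
  · refine HypersurfaceRegular.stub_hypersurfaceRegularOfPderiv k 5 f j P ?_
    rw [pderiv_cube_f k f hf j hj23, show (3 : MvPolynomial (Fin 5) k) = C (3 : k) from (map_ofNat C 3).symm]
    exact fun h => (hP'.mem_or_mem h).elim hC3 fun h' => hj (hP'.mem_of_pow_mem 2 h')
  · have hj01 : j = 0 ∨ j = 1 := by
      push Not at hj23
      fin_cases j <;> simp_all
    have hor : (X 0 : MvPolynomial (Fin 5) k) ∉ P' ∨ (X 1 : MvPolynomial (Fin 5) k) ∉ P' := by
      rcases hj01 with rfl | rfl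
      · exact Or.inl hj
      · exact Or.inr hj
    rcases hyu hor with h0 | h1
    · exact HypersurfaceRegular.stub_hypersurfaceRegularOfPderiv k 5 f 0 P h0
    · exact HypersurfaceRegular.stub_hypersurfaceRegularOfPderiv k 5 f 1 P h1

end Summit.ResolutionOfSingularities.ResolutionOfSingularities.Theorems.FInjectiveMacaulayfication.X2C31Specimen

end
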